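import Summits.Ventures.PercRepro.RankLevelSetRuleQTwoTerm
import Summits.Ventures.PercRepro.RankLevelSetRuleQThreeTermPoly

/-!
# PercRepro — (R̂) FROM THE THREE-TERM PAIRING, EVERY `k ≥ 4` (p4, gen 22; C-044; paper proofs/P4-CELL-THREE.md §11.9)

`rhat_ge_phiK_of_three (q k m) (4 ≤ k) (k − 1 ≤ q − m) (m ≤ q) (h3) : phiK (q + k) q ≤ rhat q k m`, where `h3` is the row
`J = 1` of the pairing of the `i = 0` row of `rhat_sub_phiK_eq` with the THREE top terms `i = k−1, k−2, k−3` of the diagonal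
`J + k − 1`: with `u = q − m` and `W₃(J) = (u+2)(u+3)(J+1)(J+2) + (k−1)(u+3)(m−J)(J+2) + (k−1)(k−2)(m−J)(m−J−1)`,
`6(u+2)(u+3)·Π_{i<k−1}(q+2+i) ≤ W₃(1)·k·Π_{i<k−1}(u+2+i)`.
The rows `J ≥ 2` follow from `J = 1` (`three_row_step`, through the abstract `row_transfer`: the shift needs
`W₃(J)(J+3)(q+J+k) ≤ W₃(J+1)(J+k)(q+J+1)`, a polynomial with 104 non-negative coefficients for `m ≥ J + 2` and 51 for the
last step `m = J + 1` — RankLevelSetRuleQThreeTermPoly); the pairing itself is `pairing_choose_three` (the binomial ratios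
`C(n,k−2)(u+2) = C(n,k−1)(k−1)`, `C(n,k−3)(u+3) = C(n,k−2)(k−2)`, `C(m,J+1)(J+1) = C(m,J)(m−J)`,
`C(m,J+2)(J+2) = C(m,J+1)(m−J−1)`), and the assembly keeps the three-element sub-sum of every diagonal.  Regime: thresholds
`u₀(m) ≈ m/2` (k = 5: `u₀(60) = 33`), i.e. `#P ≲ 2q/3`, against `q/2` (two terms) and `q/3` (one term); a certified point
outside the two-term regime: `rhat_hundred_five_sixty : phiK (100 + 5) 100 ≤ rhat 100 5 60` (`u = 40`:
`6·42·43·102·103·104·105 = 1,243,165,734,720 ≤ (10,836 + 30,444 + 41,064)·5·42·43·44·45 = 1,472,261,313,600`).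
Axioms: standard.
-/

namespace PercRepro

open Finset

/-- The abstract row transfer: from `A·P1·Pq ≤ W·Pu·PJ` and the step `W·j3·sk ≤ W'·jk·s` to `A'·P1·Pq' ≤ W'·Pu·PJ'`,
when `A'·j1 = A·j3`, `Pq'·s = Pq·sk`, `PJ'·j1 = PJ·jk` (the shifts of the row). -/
lemma row_transfer (A A' W W' Pu P1 PJ PJ' Pq Pq' j1 j3 jk s sk : ℕ)
    (hA : A' * j1 = A * j3) (hPq : Pq' * s = Pq * sk) (hPJ : PJ' * j1 = PJ * jk)
    (h : A * P1 * Pq ≤ W * Pu * PJ) (hstep : W * j3 * sk ≤ W' * jk * s)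
    (hj1 : 0 < j1) (hs : 0 < s) (hW : 0 < W) :
    A' * P1 * Pq' ≤ W' * Pu * PJ' := by
  have hpos : 0 < j1 * s * W := by positivity
  refine Nat.le_of_mul_le_mul_right ?_ hpos
  calc A' * P1 * Pq' * (j1 * s * W) = (A' * j1) * P1 * (Pq' * s) * W := by ring
    _ = (A * j3) * P1 * (Pq * sk) * W := by rw [hA, hPq]
    _ = (A * P1 * Pq) * (W * j3 * sk) := by ring
    _ ≤ (W * Pu * PJ) * (W' * jk * s) := Nat.mul_le_mul h hstep
    _ = W' * Pu * (PJ * jk) * s * W := by ring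
    _ = W' * Pu * (PJ' * j1) * s * W := by rw [hPJ]
    _ = W' * Pu * PJ' * (j1 * s * W) := by ring

/-- The row condition of the three-term pairing at row `J`
(`W₃(J) = (u+2)(u+3)(J+1)(J+2) + (k−1)(u+3)(m−J)(J+2) + (k−1)(k−2)(m−J)(m−J−1)`):
`(u+2)(u+3)(J+1)(J+2)·Π(1+i)·Π(u+m+J+1+i) ≤ W₃(J)·Π(u+2+i)·Π(J+1+i)`; the step `J ↦ J + 1` for `J + 1 ≤ m`. -/
lemma three_row_step (u m J k : ℕ) (hJ : 1 ≤ J) (hJm : J + 1 ≤ m) (hk : 4 ≤ k) (hu : k - 1 ≤ u)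
    (h : (u + 2) * (u + 3) * (J + 1) * (J + 2) * (∏ i ∈ range (k - 1), (1 + i)) * ∏ i ∈ range (k - 1), (u + m + J + 1 + i)
        ≤ ((u + 2) * (u + 3) * (J + 1) * (J + 2) + (k - 1) * (u + 3) * (m - J) * (J + 2)
            + (k - 1) * (k - 2) * (m - J) * (m - J - 1))
          * (∏ i ∈ range (k - 1), (u + 2 + i)) * ∏ i ∈ range (k - 1), (J + 1 + i)) :
    (u + 2) * (u + 3) * (J + 1 + 1) * (J + 1 + 2) * (∏ i ∈ range (k - 1), (1 + i))
        * ∏ i ∈ range (k - 1), (u + m + (J + 1) + 1 + i)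
      ≤ ((u + 2) * (u + 3) * (J + 1 + 1) * (J + 1 + 2) + (k - 1) * (u + 3) * (m - (J + 1)) * (J + 1 + 2)
            + (k - 1) * (k - 2) * (m - (J + 1)) * (m - (J + 1) - 1))
          * (∏ i ∈ range (k - 1), (u + 2 + i)) * ∏ i ∈ range (k - 1), (J + 1 + 1 + i) := by
  have hPJ := prod_shift (J + 1) (k - 1)
  have hPq := prod_shift (u + m + J + 1) (k - 1)
  have e1 : ∏ i ∈ range (k - 1), (u + m + J + 1 + 1 + i) = ∏ i ∈ range (k - 1), (u + m + (J + 1) + 1 + i) :=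
    Finset.prod_congr rfl (fun i _ => by ring)
  rw [e1, show u + m + J + 1 + (k - 1) = u + m + J + k by omega] at hPq
  rw [show J + 1 + (k - 1) = J + k by omega] at hPJ
  refine row_transfer _ _ _ _ _ _ _ _ _ _ (J + 1) (J + 3) (J + k) (u + m + J + 1) (u + m + J + k)
    (by ring) hPq hPJ h ?_ (by omega) (by omega) (by positivity)
  -- the polynomial step
  obtain ⟨d, rfl⟩ : ∃ d, k = d + 4 := ⟨k - 4, by omega⟩
  obtain ⟨a, rfl⟩ : ∃ a, u = d + 3 + a := ⟨u - (d + 3), by omega⟩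
  obtain ⟨b, rfl⟩ : ∃ b, J = b + 1 := ⟨J - 1, by omega⟩
  rw [show d + 4 - 1 = d + 3 by omega, show d + 4 - 2 = d + 2 by omega]
  rcases Nat.lt_or_ge (b + 1 + 1) m with hm2 | hm2
  · obtain ⟨c, rfl⟩ : ∃ c, m = b + 1 + 2 + c := ⟨m - (b + 1 + 2), by omega⟩
    rw [show b + 1 + 2 + c - (b + 1) = c + 2 by omega, show c + 2 - 1 = c + 1 by omega,
      show b + 1 + 2 + c - (b + 1 + 1) = c + 1 by omega, show c + 1 - 1 = c by omega]
    have := three_step_nat a b c d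
    calc ((d + 3 + a + 2) * (d + 3 + a + 3) * (b + 1 + 1) * (b + 1 + 2) + (d + 3) * (d + 3 + a + 3) * (c + 2) * (b + 1 + 2)
            + (d + 3) * (d + 2) * (c + 2) * (c + 1)) * (b + 1 + 3) * (d + 3 + a + (b + 1 + 2 + c) + (b + 1) + (d + 4))
        ≤ ((d + 3 + a + 2) * (d + 3 + a + 3) * (b + 1 + 2) * (b + 1 + 3)
            + (d + 3) * (d + 3 + a + 3) * (c + 1) * (b + 1 + 3) + (d + 3) * (d + 2) * (c + 1) * c)
            * ((b + 1) + (d + 4)) * ((d + 3 + a) + (b + 1 + 2 + c) + (b + 1) + 1) := this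
      _ = ((d + 3 + a + 2) * (d + 3 + a + 3) * (b + 1 + 1 + 1) * (b + 1 + 1 + 2)
            + (d + 3) * (d + 3 + a + 3) * (c + 1) * (b + 1 + 1 + 2) + (d + 3) * (d + 2) * (c + 1) * c)
            * (b + 1 + (d + 4)) * (d + 3 + a + (b + 1 + 2 + c) + (b + 1) + 1) := by ring
  · have hmeq : m = b + 1 + 1 := by omega
    subst hmeq
    rw [show b + 1 + 1 - (b + 1) = 1 by omega, show (1 : ℕ) - 1 = 0 by rfl,
      show b + 1 + 1 - (b + 1 + 1) = 0 by omega, show (0 : ℕ) - 1 = 0 by rfl]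
    have := three_step_nat_last a b d
    calc ((d + 3 + a + 2) * (d + 3 + a + 3) * (b + 1 + 1) * (b + 1 + 2) + (d + 3) * (d + 3 + a + 3) * 1 * (b + 1 + 2)
            + (d + 3) * (d + 2) * 1 * 0) * (b + 1 + 3) * (d + 3 + a + (b + 1 + 1) + (b + 1) + (d + 4))
        ≤ ((d + 3 + a + 2) * (d + 3 + a + 3) * (b + 1 + 2) * (b + 1 + 3)
            + (d + 3) * (d + 3 + a + 3) * 0 * (b + 1 + 3) + (d + 3) * (d + 2) * 0 * 0)
            * ((b + 1) + (d + 4)) * ((d + 3 + a) + (b + 1 + 1) + (b + 1) + 1) := this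
      _ = ((d + 3 + a + 2) * (d + 3 + a + 3) * (b + 1 + 1 + 1) * (b + 1 + 1 + 2)
            + (d + 3) * (d + 3 + a + 3) * 0 * (b + 1 + 1 + 2) + (d + 3) * (d + 2) * 0 * 0)
            * (b + 1 + (d + 4)) * (d + 3 + a + (b + 1 + 1) + (b + 1) + 1) := by ring


/-- From the row `J = 1` (the hypothesis) to every row `1 ≤ J ≤ m` of the three-term pairing. -/
lemma three_row_all (u m k : ℕ) (hk : 4 ≤ k) (hu : k - 1 ≤ u)
    (h3 : 6 * (u + 2) * (u + 3) * ∏ i ∈ range (k - 1), (u + m + 2 + i)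
        ≤ (6 * (u + 2) * (u + 3) + 3 * (k - 1) * (u + 3) * (m - 1) + (k - 1) * (k - 2) * (m - 1) * (m - 2)) * k
            * ∏ i ∈ range (k - 1), (u + 2 + i)) :
    ∀ J, 1 ≤ J → J ≤ m →
      (u + 2) * (u + 3) * (J + 1) * (J + 2) * (∏ i ∈ range (k - 1), (1 + i)) * ∏ i ∈ range (k - 1), (u + m + J + 1 + i)
        ≤ ((u + 2) * (u + 3) * (J + 1) * (J + 2) + (k - 1) * (u + 3) * (m - J) * (J + 2)
            + (k - 1) * (k - 2) * (m - J) * (m - J - 1))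
          * (∏ i ∈ range (k - 1), (u + 2 + i)) * ∏ i ∈ range (k - 1), (J + 1 + i) := by
  intro J hJ hJm
  induction J with
  | zero => omega
  | succ J ih =>
    rcases Nat.eq_zero_or_pos J with h0 | hpos
    · subst h0
      have e : ∏ i ∈ range (k - 1), (0 + 1 + 1 + i) = k * ∏ i ∈ range (k - 1), (1 + i) := by
        have := prod_shift 1 (k - 1)
        rw [mul_one, show 1 + (k - 1) = k by omega] at this
        have e' : ∏ i ∈ range (k - 1), (0 + 1 + 1 + i) = ∏ i ∈ range (k - 1), (1 + 1 + i) :=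
          Finset.prod_congr rfl (fun i _ => by ring)
        rw [e', this]; ring
      have e2 : ∏ i ∈ range (k - 1), (u + m + (0 + 1) + 1 + i) = ∏ i ∈ range (k - 1), (u + m + 2 + i) :=
        Finset.prod_congr rfl (fun i _ => by ring)
      rw [e, e2, show m - (0 + 1) - 1 = m - 2 by omega, show m - (0 + 1) = m - 1 by omega]
      calc (u + 2) * (u + 3) * (0 + 1 + 1) * (0 + 1 + 2) * (∏ i ∈ range (k - 1), (1 + i))
            * ∏ i ∈ range (k - 1), (u + m + 2 + i)
          = (6 * (u + 2) * (u + 3) * ∏ i ∈ range (k - 1), (u + m + 2 + i)) * ∏ i ∈ range (k - 1), (1 + i) := by ring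
        _ ≤ ((6 * (u + 2) * (u + 3) + 3 * (k - 1) * (u + 3) * (m - 1) + (k - 1) * (k - 2) * (m - 1) * (m - 2)) * k
              * ∏ i ∈ range (k - 1), (u + 2 + i)) * ∏ i ∈ range (k - 1), (1 + i) := Nat.mul_le_mul_right _ h3
        _ = ((u + 2) * (u + 3) * (0 + 1 + 1) * (0 + 1 + 2) + (k - 1) * (u + 3) * (m - 1) * (0 + 1 + 2)
              + (k - 1) * (k - 2) * (m - 1) * (m - 2)) * (∏ i ∈ range (k - 1), (u + 2 + i))
              * (k * ∏ i ∈ range (k - 1), (1 + i)) := by ring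
    · exact three_row_step u m J k hpos hJm hk hu (ih hpos (by omega))

/-- The three-term pairing in `ℕ` (row `1 ≤ J' ≤ m`, `q = u + m`, `n = u + k`, `4 ≤ k`):
`C(m,J')·C(q+J'+k−1, J'+k−1) ≤ [C(n,k−1)·C(m,J') + C(n,k−2)·C(m,J'+1) + C(n,k−3)·C(m,J'+2)]·C(q+J', J')`. -/
lemma pairing_choose_three (u m J' k : ℕ) (hk : 4 ≤ k) (hu : k - 1 ≤ u) (hJ : 1 ≤ J') (hJm : J' ≤ m)
    (h3 : 6 * (u + 2) * (u + 3) * ∏ i ∈ range (k - 1), (u + m + 2 + i)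
        ≤ (6 * (u + 2) * (u + 3) + 3 * (k - 1) * (u + 3) * (m - 1) + (k - 1) * (k - 2) * (m - 1) * (m - 2)) * k
            * ∏ i ∈ range (k - 1), (u + 2 + i)) :
    m.choose J' * (u + m + J' + (k - 1)).choose (J' + (k - 1))
      ≤ ((u + k).choose (k - 1) * m.choose J' + (u + k).choose (k - 2) * m.choose (J' + 1)
          + (u + k).choose (k - 3) * m.choose (J' + 2)) * (u + m + J').choose J' := by
  have hT := three_row_all u m k hk hu h3 J' hJ hJm
  obtain ⟨r, rfl⟩ : ∃ r, k = r + 3 := ⟨k - 3, by omega⟩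
  rw [show r + 3 - 1 = r + 2 by omega] at hT ⊢
  rw [show r + 3 - 2 = r + 1 by omega, show r + 3 - 3 = r by omega]
  have hA := choose_add_mul_prod (u + m + J') J' (r + 2)
  have hB := choose_add_mul_prod (u + 1) 0 (r + 2)
  rw [Nat.choose_zero_right, one_mul, zero_add, show u + 1 + (r + 2) = u + (r + 3) by ring] at hB
  have c1 : (u + (r + 3)).choose (r + 2) * (r + 2) = (u + (r + 3)).choose (r + 1) * (u + 2) := by
    have := Nat.choose_succ_right_eq (u + (r + 3)) (r + 1)
    rw [show u + (r + 3) - (r + 1) = u + 2 by omega] at this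
    exact this
  have c2 : (u + (r + 3)).choose (r + 1) * (r + 1) = (u + (r + 3)).choose r * (u + 3) := by
    have := Nat.choose_succ_right_eq (u + (r + 3)) r
    rw [show u + (r + 3) - r = u + 3 by omega] at this
    exact this
  have d1 : m.choose (J' + 1) * (J' + 1) = m.choose J' * (m - J') := Nat.choose_succ_right_eq m J'
  have d2 : m.choose (J' + 2) * (J' + 2) = m.choose (J' + 1) * (m - (J' + 1)) := Nat.choose_succ_right_eq m (J' + 1)
  have hpos : 0 < (u + 2) * (u + 3) * (J' + 1) * (J' + 2)
      * ((∏ i ∈ range (r + 2), (J' + 1 + i)) * ∏ i ∈ range (r + 2), (1 + i)) := by positivity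
  refine Nat.le_of_mul_le_mul_right ?_ hpos
  -- the three coefficients, multiplied out
  have k1 : (u + (r + 3)).choose (r + 1) * m.choose (J' + 1) * ((u + 2) * (u + 3) * (J' + 1) * (J' + 2))
      = (u + (r + 3)).choose (r + 2) * m.choose J' * ((r + 2) * (u + 3) * (m - J') * (J' + 2)) := by
    calc (u + (r + 3)).choose (r + 1) * m.choose (J' + 1) * ((u + 2) * (u + 3) * (J' + 1) * (J' + 2))
        = ((u + (r + 3)).choose (r + 1) * (u + 2)) * (m.choose (J' + 1) * (J' + 1)) * ((u + 3) * (J' + 2)) := by ring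
      _ = ((u + (r + 3)).choose (r + 2) * (r + 2)) * (m.choose J' * (m - J')) * ((u + 3) * (J' + 2)) := by rw [c1, d1]
      _ = (u + (r + 3)).choose (r + 2) * m.choose J' * ((r + 2) * (u + 3) * (m - J') * (J' + 2)) := by ring
  have k2 : (u + (r + 3)).choose r * m.choose (J' + 2) * ((u + 2) * (u + 3) * (J' + 1) * (J' + 2))
      = (u + (r + 3)).choose (r + 2) * m.choose J' * ((r + 2) * (r + 1) * (m - J') * (m - J' - 1)) := by
    calc (u + (r + 3)).choose r * m.choose (J' + 2) * ((u + 2) * (u + 3) * (J' + 1) * (J' + 2))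
        = ((u + (r + 3)).choose r * (u + 3)) * (m.choose (J' + 2) * (J' + 2)) * ((u + 2) * (J' + 1)) := by ring
      _ = ((u + (r + 3)).choose (r + 1) * (r + 1)) * (m.choose (J' + 1) * (m - (J' + 1))) * ((u + 2) * (J' + 1)) := by
          rw [c2, d2]
      _ = ((u + (r + 3)).choose (r + 1) * (u + 2)) * (m.choose (J' + 1) * (J' + 1)) * ((r + 1) * (m - (J' + 1))) := by
          ring
      _ = ((u + (r + 3)).choose (r + 2) * (r + 2)) * (m.choose J' * (m - J')) * ((r + 1) * (m - (J' + 1))) := by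
          rw [c1, d1]
      _ = (u + (r + 3)).choose (r + 2) * m.choose J' * ((r + 2) * (r + 1) * (m - J') * (m - J' - 1)) := by
          rw [show m - (J' + 1) = m - J' - 1 by omega]; ring
  have key : (u + m + J' + (r + 2)).choose (J' + (r + 2)) * ((u + 2) * (u + 3) * (J' + 1) * (J' + 2))
        * ((∏ i ∈ range (r + 2), (J' + 1 + i)) * ∏ i ∈ range (r + 2), (1 + i))
      ≤ (u + (r + 3)).choose (r + 2)
        * ((u + 2) * (u + 3) * (J' + 1) * (J' + 2) + (r + 2) * (u + 3) * (m - J') * (J' + 2)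
            + (r + 2) * (r + 1) * (m - J') * (m - J' - 1)) * (u + m + J').choose J'
        * ((∏ i ∈ range (r + 2), (J' + 1 + i)) * ∏ i ∈ range (r + 2), (1 + i)) := by
    calc (u + m + J' + (r + 2)).choose (J' + (r + 2)) * ((u + 2) * (u + 3) * (J' + 1) * (J' + 2))
          * ((∏ i ∈ range (r + 2), (J' + 1 + i)) * ∏ i ∈ range (r + 2), (1 + i))
        = ((u + m + J' + (r + 2)).choose (J' + (r + 2)) * ∏ i ∈ range (r + 2), (J' + 1 + i))
          * ((u + 2) * (u + 3) * (J' + 1) * (J' + 2) * ∏ i ∈ range (r + 2), (1 + i)) := by ring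
      _ = ((u + m + J').choose J' * ∏ i ∈ range (r + 2), (u + m + J' + 1 + i))
          * ((u + 2) * (u + 3) * (J' + 1) * (J' + 2) * ∏ i ∈ range (r + 2), (1 + i)) := by rw [hA]
      _ = (u + m + J').choose J' * ((u + 2) * (u + 3) * (J' + 1) * (J' + 2) * (∏ i ∈ range (r + 2), (1 + i))
          * ∏ i ∈ range (r + 2), (u + m + J' + 1 + i)) := by ring
      _ ≤ (u + m + J').choose J' * (((u + 2) * (u + 3) * (J' + 1) * (J' + 2) + (r + 2) * (u + 3) * (m - J') * (J' + 2)
          + (r + 2) * (r + 1) * (m - J') * (m - J' - 1)) * (∏ i ∈ range (r + 2), (u + 2 + i))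
          * ∏ i ∈ range (r + 2), (J' + 1 + i)) := Nat.mul_le_mul_left _ hT
      _ = (u + m + J').choose J' * (((u + 2) * (u + 3) * (J' + 1) * (J' + 2) + (r + 2) * (u + 3) * (m - J') * (J' + 2)
          + (r + 2) * (r + 1) * (m - J') * (m - J' - 1))
          * ((u + (r + 3)).choose (r + 2) * ∏ i ∈ range (r + 2), (1 + i)) * ∏ i ∈ range (r + 2), (J' + 1 + i)) := by
          rw [hB]
      _ = (u + (r + 3)).choose (r + 2)
          * ((u + 2) * (u + 3) * (J' + 1) * (J' + 2) + (r + 2) * (u + 3) * (m - J') * (J' + 2)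
            + (r + 2) * (r + 1) * (m - J') * (m - J' - 1)) * (u + m + J').choose J'
          * ((∏ i ∈ range (r + 2), (J' + 1 + i)) * ∏ i ∈ range (r + 2), (1 + i)) := by ring
  calc m.choose J' * (u + m + J' + (r + 2)).choose (J' + (r + 2))
        * ((u + 2) * (u + 3) * (J' + 1) * (J' + 2) * ((∏ i ∈ range (r + 2), (J' + 1 + i)) * ∏ i ∈ range (r + 2), (1 + i)))
      = m.choose J' * ((u + m + J' + (r + 2)).choose (J' + (r + 2)) * ((u + 2) * (u + 3) * (J' + 1) * (J' + 2))
        * ((∏ i ∈ range (r + 2), (J' + 1 + i)) * ∏ i ∈ range (r + 2), (1 + i))) := by ring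
    _ ≤ m.choose J' * ((u + (r + 3)).choose (r + 2)
        * ((u + 2) * (u + 3) * (J' + 1) * (J' + 2) + (r + 2) * (u + 3) * (m - J') * (J' + 2)
            + (r + 2) * (r + 1) * (m - J') * (m - J' - 1)) * (u + m + J').choose J'
        * ((∏ i ∈ range (r + 2), (J' + 1 + i)) * ∏ i ∈ range (r + 2), (1 + i))) := Nat.mul_le_mul_left _ key
    _ = ((u + (r + 3)).choose (r + 2) * m.choose J' * ((u + 2) * (u + 3) * (J' + 1) * (J' + 2))
        + (u + (r + 3)).choose (r + 2) * m.choose J' * ((r + 2) * (u + 3) * (m - J') * (J' + 2))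
        + (u + (r + 3)).choose (r + 2) * m.choose J' * ((r + 2) * (r + 1) * (m - J') * (m - J' - 1)))
        * (u + m + J').choose J' * ((∏ i ∈ range (r + 2), (J' + 1 + i)) * ∏ i ∈ range (r + 2), (1 + i)) := by ring
    _ = ((u + (r + 3)).choose (r + 2) * m.choose J' * ((u + 2) * (u + 3) * (J' + 1) * (J' + 2))
        + (u + (r + 3)).choose (r + 1) * m.choose (J' + 1) * ((u + 2) * (u + 3) * (J' + 1) * (J' + 2))
        + (u + (r + 3)).choose r * m.choose (J' + 2) * ((u + 2) * (u + 3) * (J' + 1) * (J' + 2)))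
        * (u + m + J').choose J' * ((∏ i ∈ range (r + 2), (J' + 1 + i)) * ∏ i ∈ range (r + 2), (1 + i)) := by
        rw [k1, k2]
    _ = ((u + (r + 3)).choose (r + 2) * m.choose J' + (u + (r + 3)).choose (r + 1) * m.choose (J' + 1)
        + (u + (r + 3)).choose r * m.choose (J' + 2)) * (u + m + J').choose J'
        * ((u + 2) * (u + 3) * (J' + 1) * (J' + 2) * ((∏ i ∈ range (r + 2), (J' + 1 + i)) * ∏ i ∈ range (r + 2), (1 + i))) := by
        ring


/-- The three-term pairing in `ℚ`, every `J`. -/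
lemma pair_term_three (u m k J : ℕ) (hk : 4 ≤ k) (hu : k - 1 ≤ u)
    (h3 : 6 * (u + 2) * (u + 3) * ∏ i ∈ range (k - 1), (u + m + 2 + i)
        ≤ (6 * (u + 2) * (u + 3) + 3 * (k - 1) * (u + 3) * (m - 1) + (k - 1) * (k - 2) * (m - 1) * (m - 2)) * k
            * ∏ i ∈ range (k - 1), (u + 2 + i)) :
    (m.choose (J + 1) : ℚ) * (1 / ((u + m + (J + 1)).choose (J + 1) : ℚ))
      ≤ (1 / ((u + m + (k + J)).choose (k + J) : ℚ))
        * (((u + k).choose (k - 1) : ℚ) * (m.choose (J + 1) : ℚ) + ((u + k).choose (k - 2) : ℚ) * (m.choose (J + 2) : ℚ)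
          + ((u + k).choose (k - 3) : ℚ) * (m.choose (J + 3) : ℚ)) := by
  rcases Nat.lt_or_ge m (J + 1) with hJm | hJm
  · rw [Nat.choose_eq_zero_of_lt hJm]
    push_cast
    rw [zero_mul]
    positivity
  · have h := pairing_choose_three u m (J + 1) k hk hu (by omega) hJm h3
    rw [show u + m + (J + 1) + (k - 1) = u + m + (k + J) by omega, show J + 1 + (k - 1) = k + J by omega,
      show J + 1 + 1 = J + 2 by ring, show J + 1 + 2 = J + 3 by ring] at h
    have hX : (0 : ℚ) < ((u + m + (J + 1)).choose (J + 1) : ℚ) := by exact_mod_cast Nat.choose_pos (by omega)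
    have hY : (0 : ℚ) < ((u + m + (k + J)).choose (k + J) : ℚ) := by exact_mod_cast Nat.choose_pos (by omega)
    have h' : ((m.choose (J + 1) : ℕ) : ℚ) * ((u + m + (k + J)).choose (k + J) : ℚ)
        ≤ ((((u + k).choose (k - 1) * m.choose (J + 1) + (u + k).choose (k - 2) * m.choose (J + 2)
          + (u + k).choose (k - 3) * m.choose (J + 3) : ℕ)) : ℚ) * ((u + m + (J + 1)).choose (J + 1) : ℚ) := by
      exact_mod_cast h
    push_cast at h'
    rw [mul_one_div, one_div_mul_eq_div, div_le_div_iff₀ hX hY]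
    linarith

/-- **(R̂) FROM THE THREE-TERM PAIRING, EVERY `k ≥ 4`**: if `6(u+2)(u+3)·Π_{i<k−1}(q+2+i) ≤ W₃(1)·k·Π_{i<k−1}(u+2+i)`
with `u = q − #P` and `W₃(1) = 6(u+2)(u+3) + 3(k−1)(u+3)(#P−1) + (k−1)(k−2)(#P−1)(#P−2)` (the row `J = 1` of the pairing
with the three top terms `i = k−1, k−2, k−3` of each diagonal) and `#P ≤ q − k + 1`, then `Φ(q+k, q) ≤ R̂(q, k, #P)`. -/
theorem rhat_ge_phiK_of_three (q k m : ℕ) (hk : 4 ≤ k) (hu : k - 1 ≤ q - m) (hm : m ≤ q)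
    (h3 : 6 * (q - m + 2) * (q - m + 3) * ∏ i ∈ range (k - 1), (q + 2 + i)
        ≤ (6 * (q - m + 2) * (q - m + 3) + 3 * (k - 1) * (q - m + 3) * (m - 1) + (k - 1) * (k - 2) * (m - 1) * (m - 2)) * k
            * ∏ i ∈ range (k - 1), (q - m + 2 + i)) :
    phiK (q + k) q ≤ rhat q k m := by
  rw [rhat_ge_phiK_iff_untrunc q k m (by omega) hu hm]
  obtain ⟨u, rfl⟩ : ∃ u, q = u + m := ⟨q - m, by omega⟩
  rw [Nat.add_sub_cancel] at h3 hu
  have hterm : ∀ J' i, i ≤ J' →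
      (if i ≤ J' ∧ J' - i ≤ m then ((u + m + k - m).choose i : ℚ) * (m.choose (J' - i) : ℚ) else 0)
        = ((u + k).choose i : ℚ) * (m.choose (J' - i) : ℚ) := by
    intro J' i hi
    rw [show u + m + k - m = u + k by omega]
    by_cases hm' : J' - i ≤ m
    · rw [if_pos ⟨hi, hm'⟩]
    · rw [if_neg (fun h => hm' h.2), Nat.choose_eq_zero_of_lt (by omega : m < J' - i)]
      simp
  have hN : ∀ J ∈ range m,
      (1 / ((u + m + (k + J)).choose (k + J) : ℚ))
          * (((u + k).choose (k - 1) : ℚ) * (m.choose (J + 1) : ℚ) + ((u + k).choose (k - 2) : ℚ) * (m.choose (J + 2) : ℚ)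
            + ((u + k).choose (k - 3) : ℚ) * (m.choose (J + 3) : ℚ))
        ≤ (1 / ((u + m + (k + J)).choose (k + J) : ℚ)) * ∑ i ∈ Ioo 0 k,
            (if i ≤ k + J ∧ k + J - i ≤ m then ((u + m + k - m).choose i : ℚ) * (m.choose (k + J - i) : ℚ) else 0) := by
    intro J _
    refine mul_le_mul_of_nonneg_left ?_ (by positivity)
    have hsub : ({k - 3, k - 2, k - 1} : Finset ℕ) ⊆ Ioo 0 k := by
      intro i hi
      simp only [Finset.mem_insert, Finset.mem_singleton] at hi
      rw [Finset.mem_Ioo]; omega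
    refine le_trans (le_of_eq ?_) (Finset.sum_le_sum_of_subset_of_nonneg hsub (fun i _ _ => by split_ifs <;> positivity))
    rw [Finset.sum_insert (by simp only [Finset.mem_insert, Finset.mem_singleton]; omega),
      Finset.sum_pair (show k - 2 ≠ k - 1 by omega), hterm (k + J) (k - 3) (by omega), hterm (k + J) (k - 2) (by omega),
      hterm (k + J) (k - 1) (by omega), show k + J - (k - 3) = J + 3 by omega, show k + J - (k - 2) = J + 2 by omega,
      show k + J - (k - 1) = J + 1 by omega]
    ring
  have hpos : ∑ J ∈ range m, (1 / ((u + m + (k + J)).choose (k + J) : ℚ))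
        * (((u + k).choose (k - 1) : ℚ) * (m.choose (J + 1) : ℚ) + ((u + k).choose (k - 2) : ℚ) * (m.choose (J + 2) : ℚ)
            + ((u + k).choose (k - 3) : ℚ) * (m.choose (J + 3) : ℚ))
      ≤ ∑ J' ∈ Ico k (k + m), (1 / ((u + m + J').choose J' : ℚ)) * ∑ i ∈ Ioo 0 k,
            (if i ≤ J' ∧ J' - i ≤ m then ((u + m + k - m).choose i : ℚ) * (m.choose (J' - i) : ℚ) else 0) := by
    rw [Finset.sum_Ico_eq_sum_range, show k + m - k = m by omega]
    exact Finset.sum_le_sum hN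
  rw [sum_Ioo_nat, show k - (0 + 1) = k - 1 by omega]
  refine le_trans ?_ hpos
  set f : ℕ → ℚ := fun J => (m.choose (0 + 1 + J) : ℚ) * (1 / ((u + m + (0 + 1 + J)).choose (0 + 1 + J) : ℚ)) with hf
  set g : ℕ → ℚ := fun J => (1 / ((u + m + (k + J)).choose (k + J) : ℚ))
        * (((u + k).choose (k - 1) : ℚ) * (m.choose (J + 1) : ℚ) + ((u + k).choose (k - 2) : ℚ) * (m.choose (J + 2) : ℚ)
            + ((u + k).choose (k - 3) : ℚ) * (m.choose (J + 3) : ℚ)) with hg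
  have hfg : ∀ J, f J ≤ g J := by
    intro J
    simp only [hf, hg, show 0 + 1 + J = J + 1 by ring]
    exact pair_term_three u m k J hk hu h3
  have hg0 : ∀ J, m ≤ J → g J = 0 := by
    intro J hJ
    simp only [hg]
    rw [Nat.choose_eq_zero_of_lt (by omega : m < J + 1), Nat.choose_eq_zero_of_lt (by omega : m < J + 2),
      Nat.choose_eq_zero_of_lt (by omega : m < J + 3)]
    simp
  have hgnn : ∀ J, 0 ≤ g J := by
    intro J
    simp only [hg]
    positivity
  calc ∑ J ∈ range (k - 1), f J ≤ ∑ J ∈ range (k - 1), g J := Finset.sum_le_sum (fun J _ => hfg J)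
    _ ≤ ∑ J ∈ range (k - 1 + m), g J :=
        Finset.sum_le_sum_of_subset_of_nonneg
          (fun x hx => by rw [Finset.mem_range] at hx ⊢; omega) (fun J _ _ => hgnn J)
    _ = ∑ J ∈ range m, g J := by
        rw [← Finset.sum_range_add_sum_Ico _ (show m ≤ k - 1 + m by omega)]
        rw [Finset.sum_eq_zero (fun J hJ => hg0 J (Finset.mem_Ico.1 hJ).1), add_zero]

variable {α : Type} (M : Matroid α) [M.Finite]

/-- **Rule Q pays `Φ(q+k, q)` to every member whose flat part satisfies the three-term condition**, every `k ≥ 4`. -/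
theorem ruleQRecv_ge_of_flatPart_three {q k : ℕ} (hk : 4 ≤ k) (hE : M.E.ncard = (q + k) + q)
    {Z : Set α} (hZ : Z ∈ cellMembers M (q + k) q) (hu : k - 1 ≤ q - (flatPart M Z).ncard)
    (h3 : 6 * (q - (flatPart M Z).ncard + 2) * (q - (flatPart M Z).ncard + 3) * ∏ i ∈ range (k - 1), (q + 2 + i)
        ≤ (6 * (q - (flatPart M Z).ncard + 2) * (q - (flatPart M Z).ncard + 3)
            + 3 * (k - 1) * (q - (flatPart M Z).ncard + 3) * ((flatPart M Z).ncard - 1)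
            + (k - 1) * (k - 2) * ((flatPart M Z).ncard - 1) * ((flatPart M Z).ncard - 2)) * k
            * ∏ i ∈ range (k - 1), (q - (flatPart M Z).ncard + 2 + i)) :
    phiK (q + k) q ≤ ruleQRecv M (q + k) q Z := by
  refine le_trans ?_ (rhat_le_ruleQRecv M hE hZ)
  have hm : (flatPart M Z).ncard ≤ q :=
    (Nat.lt_of_sub_pos (lt_of_lt_of_le (show 0 < k - 1 by omega) hu)).le
  exact rhat_ge_phiK_of_three q k _ hk hu hm h3

/-- A certified point outside the two-term regime: `#P = 60` of the cell `(105, 100)` (`k = 5`, `u = 40`). -/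
theorem rhat_hundred_five_sixty : phiK (100 + 5) 100 ≤ rhat 100 5 60 :=
  rhat_ge_phiK_of_three 100 5 60 (by norm_num) (by norm_num) (by norm_num) (by decide)

end PercRepro
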